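import Summits.QuantumFields.BalabanUV.Beta.CombChartJointEnd
import Summits.QuantumFields.BalabanUV.Beta.CombChartHColumnWard
import Summits.QuantumFields.BalabanUV.Beta.CombChartWardSockets

/-!
# `BalabanUV.Beta.CombChartWardEnd` — binder row D1, RULING R-D1-g35-1 (chart (III′)), brick P4w-ii: **THE WARD-TRANSVERSALITY BINDER hW OF THE
# CHART-(III′) LITERAL `JsB12CombShSym` FROM THE WARD LETTERS OF THE UNDRESSED JETS** — `KernelWardRelative.wardTransversal_flipK_hessKer_conj_rel` at
# `(K, 𝕄, E) := (GcombSh Lc j, bhKStepSh 3 Lc (Dsh Lc) j, axEc ρ_c Lc)` through the kernel identity `CombChartJointEnd.TbalOf_dressSymAt_dressAt`, with EVERY literal-independent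
# socket a THEOREM: `hR` = P2, `hH` = `CombChartHColumnWard.colH_ward_GcombSh` (`cH j = (stepScale 3 Lc j · Lc⁴)⁻¹`), `hEX`∕`hEX₂` = diagonal commutation; and THE ROW's END
# with hW DERIVED: `D1Drift Lc (JsB12CombShSym …) Nc μ ν ⟸ (Sd) ∧ (Wd)+hN0 ∧ (Sr-conj) ∧ (Wr-conj-rem)+hRm0 ∧ D1Tel ∧ D1Rep`
# (the (III′) sibling of `KernelWardSymEnd` §1–§2 + `RowD1JointEndSym` §3 + `RowD1JointEndSymLetters`)

HONEST FRAMING (cell contract, verbatim): «discharging `BetaPertH` makes Bałaban's UV stability UNCONDITIONAL — a real constructive-QFT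
result; it is NOT the continuum limit and NOT the Clay problem.»  HONEST DEPENDENCY: continuum YM on T⁴ ⇐ BetaPertH ∧ nine spine estimates (0/9 proved);
BetaPertH ⇐ (D1) ∧ (D4) ∧ CAP+tail; G-an2-4 gates asym, D1 and NE2/3/4.
DERIVED cell leaf ([folklore] wiring BY NAME; β sub-cell, BINDER-OWNERS row D1 OWNER `b2b-balaban-beta-an2` gen 36).  No statement of Bałaban's papers, no `[cite:]`,
no `Prop` fact, no `def`.  WHAT:
* §1 **`wardTransversal_flipK_TbalOf_combSym_rel`** (generic undressed `Js⁰`): `∀ j, WardTransversal (flipK (TbalOf Lc (dressSymAt ρ_c ∘ dressAt ρ_c ∘ Js⁰) j))` ⟸ (St)(Wt),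
  the block stencil Ward law (Sd) `cH j • Σ_{v∈box} divV (Js⁰ j).S (Lc•y+v) = conjV (bhKStepSh 3 Lc (Dsh Lc) j) (diagK (x j y))` with a DIAGONAL generator (`Loc`), and the
  second-order pure-gauge law (Wd) `divW (Js⁰ j).W y ν y′ = conjW (bhKStepSh …) 0 (vertexOfK (GcombSh Lc j) Lc (Js⁰ j).S ν y′) (diagK (x j y)) 0 (X₂w j y ν y′) + Nr j y ν y′`
  with a `Loc` remainder of zero tadpole against `GcombSh Lc j` (`hN0`) — NO OTHER socket displayed; **`…_rel_parity`**: `hN0` replaced by the structural parity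
  `hNt : trK (Nr …) = −sgnK (Nr …)` (`tadpole_eq_zero_of_parity` + `CombChartWardSockets.trK_GcombSh`).
* §2 **`wardTransversal_flipK_TbalOf_JsB12CombShSym_rel`**: the literal ((St)(Wt) by `JsB12CombSh0_S∕W_translate`).
* §2b∕§3b the PARITY forms `wardTransversal_flipK_TbalOf_JsB12CombShSym_rel_parity`, `d1Drift_JsB12CombShSym_of_wardLettersParity_reflLettersRem_D1Tel_D1Rep` (`hNt`).
* §3 **`d1Drift_JsB12CombShSym_of_wardLetters_reflLettersRem_D1Tel_D1Rep`** = `CombChartJointEnd.d1Drift_JsB12CombShSym_of_hW_reflLettersRem_D1Tel_D1Rep` with `hW := §2`: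
  the chart-(III′) row END displaying ONLY jet letters of the undressed comb-chart jets — hW side (Sd)(Wd)+`hN0`, hR side (Sr-conj)(Wr-conj-rem)+`hRm0` — plus
  `D1Tel`, `D1Rep`, the printed B5 facts and the window (the (III′) sibling of `RowD1JointEndSymLetters.d1Drift_dressSymCtr_of_jetLetters_D1Tel_D1Rep`: NO literal-independent
  socket remains displayed).
HONEST: composition by name; the letters are displayed BINDERS ((Sr-conj) is reduced to an1's first-order table letters by `ReflectionLocusCombShift.hSrC_JsB12CombSh0`;
(Sd), (Wd), (Wr-conj-rem) reductions = P4c, open); repair-track root classes {hW-letters, hR-letters + hRm0 + hN0, D1Tel, D1Rep} 0∕4 discharged; row D1 binders 0∕4;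
RECORD = ROOT M′ p303989; NOT D1, NOT `BetaPertH`, NOT continuum, NOT Clay.
Provenance: β sub-cell, unit beta-an2 gen 36, 2026-08-22 (v1); over `CombChartJointEnd` (E′), `CombChartHColumnWard`, `CombChartWardSockets`, `KernelWardRelative(End)`,
P1∕P2∕P3, leaf-03's `DiagonalContact` BY NAME; no existing file touched.
-/

noncomputable section

open Finset
open scoped BigOperators
open Literature.MathematicalPhysics.QuantumFieldTheory
open Literature.MathematicalPhysics.QuantumFieldTheory.Balaban1983to89
open Literature.MathematicalPhysics.QuantumFieldTheory.Balaban1983to89.Beta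
open Literature.MathematicalPhysics.QuantumFieldTheory.Balaban1983to89.Beta.VectorTailsLoc (fam kfam)
open Literature.MathematicalPhysics.QuantumFieldTheory.Balaban1983to89.Beta.VectorLegVolumeAdapter (MvE)
open B6BondElimination (unitVec)
open ExpKernelCalculus (MKer Decays BiLoc comp tr tadpole shiftK)
open PolarizationSign (reflSign WardTransversal AxisReflectionCovariant)
open KernelReflection (refK)
open ResolventReflection (bref Φ)
open KernelWard (divV divW)
open AffineAveraging (box toSite)
open AveragingContoursRooted (ctr ctrOff ctrOff_mem_box)
open OneStepResolventKernel (Fib LocStencil JetData)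
open OneStepKernelFamily (KInvStep colH vertexOfK TbalOf flipK D1Tel D1Rep D1Drift)
open Summit.QuantumFields.BalabanUV.Beta.TameKernelCalculus
open Summit.QuantumFields.BalabanUV.Beta.ChartConjugation (conjV conjW)
open Summit.QuantumFields.BalabanUV.Beta.ChartConjugationRelative (RelInv)
open Summit.QuantumFields.BalabanUV.Beta.AxialDressingRooted (one_le_of_neZero dressAt axEc spr_axEc)
open Summit.QuantumFields.BalabanUV.Beta.SymmetrisedDressingDress (dressSymAt)
open Summit.QuantumFields.BalabanUV.Beta.SymmetrisedStepJets (SymTables)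
open Summit.QuantumFields.BalabanUV.Beta.SymShiftedSpread (bhKStepSh spr_bhKStepSh)
open Summit.QuantumFields.BalabanUV.Beta.DshAn1 (Dsh spr_Dsh)
open Summit.QuantumFields.BalabanUV.Beta.BorderedHessian (stepScale diagK comp_axEc_diagK_comm)
open Summit.QuantumFields.BalabanUV.Beta.KernelWardRelative (gaugeWt wardTransversal_flipK_hessKer_conj_rel)
open Summit.QuantumFields.BalabanUV.Beta.CombChartStepJets (GcombSh decays_GcombSh shiftK_GcombSh JsB12CombSh0 JsB12CombSh0_S_translate JsB12CombSh0_W_translate)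
open Summit.QuantumFields.BalabanUV.Beta.RelInvCombShiftedSpread (relInv_coDressKAt_Gsym_bhKStepSh)
open Summit.QuantumFields.BalabanUV.Beta.CombChartHColumnWard (colH_ward_GcombSh)
open Summit.QuantumFields.BalabanUV.Beta.CombChartContactFactor (spr_GcombSh)
open Summit.QuantumFields.BalabanUV.Beta.CombChartWardSockets (trK_GcombSh)
open Summit.QuantumFields.BalabanUV.Beta.KernelWardRelativeEnd (tadpole_eq_zero_of_parity)
open Summit.QuantumFields.BalabanUV.Beta.BorderedHessian (sgnK)
open Summit.QuantumFields.BalabanUV.Beta.CombChartJointEnd (JsB12CombShSym TbalOf_dressSymAt_dressAt d1Drift_JsB12CombShSym_of_hW_reflLettersRem_D1Tel_D1Rep)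

namespace Summit.QuantumFields.BalabanUV.Beta.CombChartWardEnd

variable {Lc : ℕ} [NeZero Lc]

/-! ## §1 hW for the doubly dressed family from the Ward letters of the undressed jets — sockets DISCHARGED -/

/-- [folklore] **hW FOR `dressSymAt ρ_c ∘ dressAt ρ_c ∘ Js⁰` OVER THE CHART-(III′) TRIPLE, SOCKETS DISCHARGED.**  Undressed jets `Js⁰` with (St)(Wt); a DIAGONAL pure-gauge
generator `diagK (x j y)` (`Loc`), second-order Ward contacts `X₂w j y ν y′` (`Loc`, commuting with `axEc ρ_c`; `0` downstream), a `Loc` remainder `Nr`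
with `tadpole (GcombSh Lc j) (Nr …) = 0`; the block
stencil Ward law (Sd) at the constant `cH j = (stepScale 3 Lc j · Lc⁴)⁻¹` and the second-order pure-gauge law (Wd) of `Js⁰` against `bhKStepSh 3 Lc (Dsh Lc) j`.
CONCLUSION: `∀ j, WardTransversal (flipK (TbalOf Lc (dressSymAt ρ_c ∘ dressAt ρ_c ∘ Js⁰) j))`.  Kernel side (`decays_GcombSh`, `shiftK_GcombSh`, `colH_ward_GcombSh`),
inverse side (P2, spreads) and the commutations (`comp_axEc_diagK_comm`) are THEOREMS. -/
theorem wardTransversal_flipK_TbalOf_combSym_rel (Js : ℕ → JetData 3 Lc)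
    (hSt : ∀ (j : ℕ) (κ' : Fin 4) (u t : Fin 4 → ℤ), (Js j).S κ' (u + (Lc : ℤ) • t) = shiftK (-((Lc : ℤ) • t)) ((Js j).S κ' u))
    (hWt : ∀ (j : ℕ) (μ : Fin 4) (y : Fin 4 → ℤ) (ν : Fin 4) (y' t : Fin 4 → ℤ),
      (Js j).W μ (y + t) ν (y' + t) = shiftK (-((Lc : ℤ) • t)) ((Js j).W μ y ν y'))
    (x : ℕ → (Fin 4 → ℤ) → (Fin 4 → ℤ) → Fib 3 → ℝ) (hX : ∀ j y, Loc (diagK (x j y)))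
    (X₂w : ℕ → (Fin 4 → ℤ) → Fin 4 → (Fin 4 → ℤ) → MKer 4 (Fib 3)) (hX₂w : ∀ j y ν y', Loc (X₂w j y ν y'))
    (hEX₂w : ∀ j y ν y', comp (axEc (ctr 4 Lc) Lc) (X₂w j y ν y') = comp (X₂w j y ν y') (axEc (ctr 4 Lc) Lc))
    (Nr : ℕ → (Fin 4 → ℤ) → Fin 4 → (Fin 4 → ℤ) → MKer 4 (Fib 3)) (hNr : ∀ j y ν y', Loc (Nr j y ν y'))
    (hSd : ∀ (j : ℕ) (y : Fin 4 → ℤ), (stepScale 3 Lc j * (Lc : ℝ) ^ (3 + 1))⁻¹ • ∑ v ∈ box 4 Lc, divV (Js j).S ((Lc : ℤ) • y + toSite v) =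
      conjV (bhKStepSh 3 Lc (Dsh Lc) j) (diagK (x j y)))
    (hWd : ∀ (j : ℕ) (y : Fin 4 → ℤ) (ν : Fin 4) (y' : Fin 4 → ℤ),
      divW (Js j).W y ν y' = conjW (bhKStepSh 3 Lc (Dsh Lc) j) 0 (vertexOfK (GcombSh Lc j) Lc (Js j).S ν y') (diagK (x j y)) 0 (X₂w j y ν y') + Nr j y ν y')
    (hN0 : ∀ j y ν y', tadpole (GcombSh Lc j) (Nr j y ν y') = 0) :
    ∀ j : ℕ, WardTransversal (flipK (TbalOf Lc (fun j => dressSymAt (ctrOff_mem_box (d := 4) (one_le_of_neZero Lc))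
        (dressAt (ctrOff_mem_box (d := 4) (one_le_of_neZero Lc)) (Js j))) j)) := by
  intro j
  rw [TbalOf_dressSymAt_dressAt Js j]
  exact wardTransversal_flipK_hessKer_conj_rel (d := 3) (N := Lc) (decays_GcombSh Lc j) (shiftK_GcombSh Lc j) (one_le_of_neZero Lc)
    (spr_bhKStepSh (spr_Dsh (one_le_of_neZero Lc)) j) (spr_axEc _ _) (relInv_coDressKAt_Gsym_bhKStepSh j) (Js j) (hSt j) (hWt j)
    ((stepScale 3 Lc j * (Lc : ℝ) ^ (3 + 1))⁻¹) (fun y κ' u => colH_ward_GcombSh (d := 3) (Lc := Lc) j y κ' u)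
    (fun y => diagK (x j y)) (hX j) (fun y => comp_axEc_diagK_comm _ _ _) (X₂w j) (Nr j) (hX₂w j) (hNr j)
    (hEX₂w j) (hSd j) (hWd j) (hN0 j)

/-- [folklore] **THE SAME, PARITY FORM OF THE REMAINDER** (twin of `KernelWardSymEnd.wardTransversal_flipK_TbalOf_dressSymAt_rel_parity`): the scalar socket
`hN0 : tadpole (GcombSh Lc j) (Nr …) = 0` REPLACED by the structural one `hNt : trK (Nr …) = −sgnK (Nr …)` — discharged inside by
`KernelWardRelativeEnd.tadpole_eq_zero_of_parity`, the comb-chart resolvents being sgn-symmetric (`CombChartWardSockets.trK_GcombSh`) and spread. -/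
theorem wardTransversal_flipK_TbalOf_combSym_rel_parity (Js : ℕ → JetData 3 Lc)
    (hSt : ∀ (j : ℕ) (κ' : Fin 4) (u t : Fin 4 → ℤ), (Js j).S κ' (u + (Lc : ℤ) • t) = shiftK (-((Lc : ℤ) • t)) ((Js j).S κ' u))
    (hWt : ∀ (j : ℕ) (μ : Fin 4) (y : Fin 4 → ℤ) (ν : Fin 4) (y' t : Fin 4 → ℤ),
      (Js j).W μ (y + t) ν (y' + t) = shiftK (-((Lc : ℤ) • t)) ((Js j).W μ y ν y'))
    (x : ℕ → (Fin 4 → ℤ) → (Fin 4 → ℤ) → Fib 3 → ℝ) (hX : ∀ j y, Loc (diagK (x j y)))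
    (X₂w : ℕ → (Fin 4 → ℤ) → Fin 4 → (Fin 4 → ℤ) → MKer 4 (Fib 3)) (hX₂w : ∀ j y ν y', Loc (X₂w j y ν y'))
    (hEX₂w : ∀ j y ν y', comp (axEc (ctr 4 Lc) Lc) (X₂w j y ν y') = comp (X₂w j y ν y') (axEc (ctr 4 Lc) Lc))
    (Nr : ℕ → (Fin 4 → ℤ) → Fin 4 → (Fin 4 → ℤ) → MKer 4 (Fib 3)) (hNr : ∀ j y ν y', Loc (Nr j y ν y'))
    (hSd : ∀ (j : ℕ) (y : Fin 4 → ℤ), (stepScale 3 Lc j * (Lc : ℝ) ^ (3 + 1))⁻¹ • ∑ v ∈ box 4 Lc, divV (Js j).S ((Lc : ℤ) • y + toSite v) =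
      conjV (bhKStepSh 3 Lc (Dsh Lc) j) (diagK (x j y)))
    (hWd : ∀ (j : ℕ) (y : Fin 4 → ℤ) (ν : Fin 4) (y' : Fin 4 → ℤ),
      divW (Js j).W y ν y' = conjW (bhKStepSh 3 Lc (Dsh Lc) j) 0 (vertexOfK (GcombSh Lc j) Lc (Js j).S ν y') (diagK (x j y)) 0 (X₂w j y ν y') + Nr j y ν y')
    (hNt : ∀ j y ν y', trK (Nr j y ν y') = -sgnK (Nr j y ν y')) :
    ∀ j : ℕ, WardTransversal (flipK (TbalOf Lc (fun j => dressSymAt (ctrOff_mem_box (d := 4) (one_le_of_neZero Lc))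
        (dressAt (ctrOff_mem_box (d := 4) (one_le_of_neZero Lc)) (Js j))) j)) :=
  wardTransversal_flipK_TbalOf_combSym_rel Js hSt hWt x hX X₂w hX₂w hEX₂w Nr hNr hSd hWd
    (fun j y ν y' => tadpole_eq_zero_of_parity (spr_GcombSh (d := 3) (Lc := Lc) j) (trK_GcombSh (d := 3) (Lc := Lc) j) (hNr j y ν y') (hNt j y ν y'))

/-! ## §2 hW for the chart-(III′) literal -/

/-- [folklore] **hW FOR THE CHART-(III′) LITERAL `JsB12CombShSym` FROM ITS UNDRESSED WARD LETTERS** — §1 at `Js⁰ := JsB12CombSh⁰ hLc N tabs cΛ cB`, (St)(Wt) DISCHARGED.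
Displayed: (Sd) with a diagonal generator, (Wd) with diagonal contacts and a remainder, `hN0` — nothing else. -/
theorem wardTransversal_flipK_TbalOf_JsB12CombShSym_rel (hLc : Odd Lc) (N : ℕ) (tabs : SymTables 3 Lc) (cΛ cB : ℝ)
    (x : ℕ → (Fin 4 → ℤ) → (Fin 4 → ℤ) → Fib 3 → ℝ) (hX : ∀ j y, Loc (diagK (x j y)))
    (X₂w : ℕ → (Fin 4 → ℤ) → Fin 4 → (Fin 4 → ℤ) → MKer 4 (Fib 3)) (hX₂w : ∀ j y ν y', Loc (X₂w j y ν y'))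
    (hEX₂w : ∀ j y ν y', comp (axEc (ctr 4 Lc) Lc) (X₂w j y ν y') = comp (X₂w j y ν y') (axEc (ctr 4 Lc) Lc))
    (Nr : ℕ → (Fin 4 → ℤ) → Fin 4 → (Fin 4 → ℤ) → MKer 4 (Fib 3)) (hNr : ∀ j y ν y', Loc (Nr j y ν y'))
    (hSd : ∀ (j : ℕ) (y : Fin 4 → ℤ), (stepScale 3 Lc j * (Lc : ℝ) ^ (3 + 1))⁻¹ • ∑ v ∈ box 4 Lc, divV (JsB12CombSh0 hLc N tabs cΛ cB j).S ((Lc : ℤ) • y + toSite v) =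
      conjV (bhKStepSh 3 Lc (Dsh Lc) j) (diagK (x j y)))
    (hWd : ∀ (j : ℕ) (y : Fin 4 → ℤ) (ν : Fin 4) (y' : Fin 4 → ℤ),
      divW (JsB12CombSh0 hLc N tabs cΛ cB j).W y ν y' =
        conjW (bhKStepSh 3 Lc (Dsh Lc) j) 0 (vertexOfK (GcombSh Lc j) Lc (JsB12CombSh0 hLc N tabs cΛ cB j).S ν y') (diagK (x j y)) 0 (X₂w j y ν y') + Nr j y ν y')
    (hN0 : ∀ j y ν y', tadpole (GcombSh Lc j) (Nr j y ν y') = 0) :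
    ∀ j : ℕ, WardTransversal (flipK (TbalOf Lc (JsB12CombShSym hLc N tabs cΛ cB) j)) :=
  wardTransversal_flipK_TbalOf_combSym_rel (fun j => JsB12CombSh0 hLc N tabs cΛ cB j)
    (fun j κ' u t => JsB12CombSh0_S_translate hLc N tabs cΛ cB j κ' u t) (fun j μ y ν y' t => JsB12CombSh0_W_translate hLc N tabs cΛ cB j μ y ν y' t)
    x hX X₂w hX₂w hEX₂w Nr hNr hSd hWd hN0

/-- [folklore] **hW FOR THE CHART-(III′) LITERAL, PARITY FORM OF THE REMAINDER** — §1's parity form at `Js⁰ := JsB12CombSh⁰ …` ((St)(Wt) discharged). -/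
theorem wardTransversal_flipK_TbalOf_JsB12CombShSym_rel_parity (hLc : Odd Lc) (N : ℕ) (tabs : SymTables 3 Lc) (cΛ cB : ℝ)
    (x : ℕ → (Fin 4 → ℤ) → (Fin 4 → ℤ) → Fib 3 → ℝ) (hX : ∀ j y, Loc (diagK (x j y)))
    (X₂w : ℕ → (Fin 4 → ℤ) → Fin 4 → (Fin 4 → ℤ) → MKer 4 (Fib 3)) (hX₂w : ∀ j y ν y', Loc (X₂w j y ν y'))
    (hEX₂w : ∀ j y ν y', comp (axEc (ctr 4 Lc) Lc) (X₂w j y ν y') = comp (X₂w j y ν y') (axEc (ctr 4 Lc) Lc))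
    (Nr : ℕ → (Fin 4 → ℤ) → Fin 4 → (Fin 4 → ℤ) → MKer 4 (Fib 3)) (hNr : ∀ j y ν y', Loc (Nr j y ν y'))
    (hSd : ∀ (j : ℕ) (y : Fin 4 → ℤ), (stepScale 3 Lc j * (Lc : ℝ) ^ (3 + 1))⁻¹ • ∑ v ∈ box 4 Lc, divV (JsB12CombSh0 hLc N tabs cΛ cB j).S ((Lc : ℤ) • y + toSite v) =
      conjV (bhKStepSh 3 Lc (Dsh Lc) j) (diagK (x j y)))
    (hWd : ∀ (j : ℕ) (y : Fin 4 → ℤ) (ν : Fin 4) (y' : Fin 4 → ℤ),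
      divW (JsB12CombSh0 hLc N tabs cΛ cB j).W y ν y' =
        conjW (bhKStepSh 3 Lc (Dsh Lc) j) 0 (vertexOfK (GcombSh Lc j) Lc (JsB12CombSh0 hLc N tabs cΛ cB j).S ν y') (diagK (x j y)) 0 (X₂w j y ν y') + Nr j y ν y')
    (hNt : ∀ j y ν y', trK (Nr j y ν y') = -sgnK (Nr j y ν y')) :
    ∀ j : ℕ, WardTransversal (flipK (TbalOf Lc (JsB12CombShSym hLc N tabs cΛ cB) j)) :=
  wardTransversal_flipK_TbalOf_combSym_rel_parity (fun j => JsB12CombSh0 hLc N tabs cΛ cB j)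
    (fun j κ' u t => JsB12CombSh0_S_translate hLc N tabs cΛ cB j κ' u t) (fun j μ y ν y' t => JsB12CombSh0_W_translate hLc N tabs cΛ cB j μ y ν y' t)
    x hX X₂w hX₂w hEX₂w Nr hNr hSd hWd hNt

/-! ## §3 The chart-(III′) row END displaying jet letters only -/

/-- **ROW D1, CHART-(III′) LITERAL, JetData-LEVEL END FROM THE JET LETTERS ALONE:
`D1Drift Lc (JsB12CombShSym …) Nc μ ν ⟸ (Sd) ∧ (Wd)+hN0 ∧ (Sr-conj) ∧ (Wr-conj-rem)+hRm0 ∧ D1Tel ∧ D1Rep`** (+ the route theorem's own binders) —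
`CombChartJointEnd.d1Drift_JsB12CombShSym_of_hW_reflLettersRem_D1Tel_D1Rep` with `hW` SUPPLIED by §2.  HONEST: no letter is proved here; repair-track root classes 0∕4;
RECORD = ROOT M′ p303989; NOT D1, NOT `BetaPertH`, NOT continuum, NOT Clay. -/
theorem d1Drift_JsB12CombShSym_of_wardLetters_reflLettersRem_D1Tel_D1Rep (hLc : Odd Lc) (hL2 : 2 ≤ Lc) (N : ℕ) (tabs : SymTables 3 Lc) (cΛ cB : ℝ)
    -- hW side: the Ward letters of the undressed comb-chart jets
    (x : ℕ → (Fin 4 → ℤ) → (Fin 4 → ℤ) → Fib 3 → ℝ) (hX : ∀ j y, Loc (diagK (x j y)))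
    (X₂w : ℕ → (Fin 4 → ℤ) → Fin 4 → (Fin 4 → ℤ) → MKer 4 (Fib 3)) (hX₂w : ∀ j y ν y', Loc (X₂w j y ν y'))
    (hEX₂w : ∀ j y ν y', comp (axEc (ctr 4 Lc) Lc) (X₂w j y ν y') = comp (X₂w j y ν y') (axEc (ctr 4 Lc) Lc))
    (Nr : ℕ → (Fin 4 → ℤ) → Fin 4 → (Fin 4 → ℤ) → MKer 4 (Fib 3)) (hNr : ∀ j y ν y', Loc (Nr j y ν y'))
    (hSd : ∀ (j : ℕ) (y : Fin 4 → ℤ), (stepScale 3 Lc j * (Lc : ℝ) ^ (3 + 1))⁻¹ • ∑ v ∈ box 4 Lc, divV (JsB12CombSh0 hLc N tabs cΛ cB j).S ((Lc : ℤ) • y + toSite v) =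
      conjV (bhKStepSh 3 Lc (Dsh Lc) j) (diagK (x j y)))
    (hWd : ∀ (j : ℕ) (y : Fin 4 → ℤ) (ν : Fin 4) (y' : Fin 4 → ℤ),
      divW (JsB12CombSh0 hLc N tabs cΛ cB j).W y ν y' =
        conjW (bhKStepSh 3 Lc (Dsh Lc) j) 0 (vertexOfK (GcombSh Lc j) Lc (JsB12CombSh0 hLc N tabs cΛ cB j).S ν y') (diagK (x j y)) 0 (X₂w j y ν y') + Nr j y ν y')
    (hN0 : ∀ j y ν y', tadpole (GcombSh Lc j) (Nr j y ν y') = 0)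
    -- hR side: the reflection letters of the undressed comb-chart jets, diagonal contacts, tadpole-null remainder
    (c : ℕ → Fin 4 → Fin 4 → (Fin 4 → ℤ) → (Fin 4 → ℤ) → Fib 3 → ℝ) (Cc δc : ℕ → ℝ)
    (hC : ∀ j α, LocStencil (fun κ u => diagK (c j α κ u)) (Cc j) (δc j)) (hδc : ∀ j, 0 < δc j)
    (x₂ : ℕ → Fin 4 → Fin 4 → (Fin 4 → ℤ) → Fin 4 → (Fin 4 → ℤ) → (Fin 4 → ℤ) → Fib 3 → ℝ)
    (hX₂ : ∀ j α μ y ν y', Loc (diagK (x₂ j α μ y ν y')))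
    (Rm : ℕ → Fin 4 → Fin 4 → (Fin 4 → ℤ) → Fin 4 → (Fin 4 → ℤ) → MKer 4 (Fib 3))
    (hRmL : ∀ j α μ y ν y', Loc (Rm j α μ y ν y'))
    (hRm0 : ∀ j α μ y ν y', tadpole (GcombSh Lc j) (Rm j α μ y ν y') = 0)
    (hSrC : ∀ (j : ℕ) (α κ' : Fin 4) (u : Fin 4 → ℤ),
      (JsB12CombSh0 hLc N tabs cΛ cB j).S κ' (bref α κ' u) =
        reflSign α κ' • refK (Φ Lc α) ((JsB12CombSh0 hLc N tabs cΛ cB j).S κ' u + conjV (bhKStepSh 3 Lc (Dsh Lc) j) (diagK (c j α κ' u))))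
    (hWrC : ∀ (j : ℕ) (α μ : Fin 4) (y : Fin 4 → ℤ) (ν : Fin 4) (y' : Fin 4 → ℤ),
      (JsB12CombSh0 hLc N tabs cΛ cB j).W μ (bref α μ y) ν (bref α ν y') = (reflSign α μ * reflSign α ν) • refK (Φ Lc α)
        ((JsB12CombSh0 hLc N tabs cΛ cB j).W μ y ν y' +
          conjW (bhKStepSh 3 Lc (Dsh Lc) j) (vertexOfK (GcombSh Lc j) Lc (JsB12CombSh0 hLc N tabs cΛ cB j).S μ y)
            (vertexOfK (GcombSh Lc j) Lc (JsB12CombSh0 hLc N tabs cΛ cB j).S ν y')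
            (vertexOfK (GcombSh Lc j) Lc (fun κ u => diagK (c j α κ u)) μ y) (vertexOfK (GcombSh Lc j) Lc (fun κ u => diagK (c j α κ u)) ν y')
            (diagK (x₂ j α μ y ν y')) + Rm j α μ y ν y'))
    -- the route theorem's own binders, verbatim
    (a : ℝ) (ha : 0 < a)
    (h12 : B5.Prop12Printed (fam (fun i : ℕ+ × ℕ => ((i.1 : ℕ+) : ℕ)) (fun i => i.1.pos) MvE a ha))
    (h126 : B5.Kernel126_127Printed (kfam (fun i : ℕ+ × ℕ => ((i.1 : ℕ+) : ℕ)) MvE))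
    {L : Type*} {SL : Finset L} (hSL : SL.Nonempty) (k : L → Fin 4) {μ ν : Fin 4} (hμν : μ ≠ ν) {Nc : ℝ} (hNc : Nc ≠ 0)
    (Jc : ∀ m : ℕ, JetData 3 (Lc ^ m)) (htel : D1Tel Lc (JsB12CombShSym hLc N tabs cΛ cB) Jc)
    {cc : ℝ} {Mw : ℕ → ℕ} (hc : 1 ≤ cc) (hMw : ∀ L : ℕ, 2 ≤ L → 1 ≤ Mw L ∧ (L : ℝ) ≤ cc * Mw L) (hML : ∀ L : ℕ, 2 ≤ L → Mw L ≤ L)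
    (hrep : D1Rep Lc Jc Nc μ ν a SL k) :
    D1Drift Lc (JsB12CombShSym hLc N tabs cΛ cB) Nc μ ν :=
  d1Drift_JsB12CombShSym_of_hW_reflLettersRem_D1Tel_D1Rep hLc hL2 N tabs cΛ cB
    (wardTransversal_flipK_TbalOf_JsB12CombShSym_rel hLc N tabs cΛ cB x hX X₂w hX₂w hEX₂w Nr hNr hSd hWd hN0)
    c Cc δc hC hδc x₂ hX₂ Rm hRmL hRm0 hSrC hWrC a ha h12 h126 hSL k hμν hNc Jc htel hc hMw hML hrep

/-- **THE SAME END, PARITY FORM OF THE WARD REMAINDER** (`hNt : trK (Nr …) = −sgnK (Nr …)` in place of `hN0`; the shape in which the slot-generic second-order Ward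
chain delivers `Nr`): `D1Drift Lc (JsB12CombShSym …) Nc μ ν ⟸ (Sd) ∧ (Wd)+hNt ∧ (Sr-conj) ∧ (Wr-conj-rem)+hRm0 ∧ D1Tel ∧ D1Rep`.  HONEST: no letter is proved here; repair-track root classes 0∕4;
RECORD = ROOT M′ p303989; NOT D1, NOT `BetaPertH`, NOT continuum, NOT Clay. -/
theorem d1Drift_JsB12CombShSym_of_wardLettersParity_reflLettersRem_D1Tel_D1Rep (hLc : Odd Lc) (hL2 : 2 ≤ Lc) (N : ℕ) (tabs : SymTables 3 Lc) (cΛ cB : ℝ)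
    -- hW side: the Ward letters of the undressed comb-chart jets
    (x : ℕ → (Fin 4 → ℤ) → (Fin 4 → ℤ) → Fib 3 → ℝ) (hX : ∀ j y, Loc (diagK (x j y)))
    (X₂w : ℕ → (Fin 4 → ℤ) → Fin 4 → (Fin 4 → ℤ) → MKer 4 (Fib 3)) (hX₂w : ∀ j y ν y', Loc (X₂w j y ν y'))
    (hEX₂w : ∀ j y ν y', comp (axEc (ctr 4 Lc) Lc) (X₂w j y ν y') = comp (X₂w j y ν y') (axEc (ctr 4 Lc) Lc))
    (Nr : ℕ → (Fin 4 → ℤ) → Fin 4 → (Fin 4 → ℤ) → MKer 4 (Fib 3)) (hNr : ∀ j y ν y', Loc (Nr j y ν y'))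
    (hSd : ∀ (j : ℕ) (y : Fin 4 → ℤ), (stepScale 3 Lc j * (Lc : ℝ) ^ (3 + 1))⁻¹ • ∑ v ∈ box 4 Lc, divV (JsB12CombSh0 hLc N tabs cΛ cB j).S ((Lc : ℤ) • y + toSite v) =
      conjV (bhKStepSh 3 Lc (Dsh Lc) j) (diagK (x j y)))
    (hWd : ∀ (j : ℕ) (y : Fin 4 → ℤ) (ν : Fin 4) (y' : Fin 4 → ℤ),
      divW (JsB12CombSh0 hLc N tabs cΛ cB j).W y ν y' =
        conjW (bhKStepSh 3 Lc (Dsh Lc) j) 0 (vertexOfK (GcombSh Lc j) Lc (JsB12CombSh0 hLc N tabs cΛ cB j).S ν y') (diagK (x j y)) 0 (X₂w j y ν y') + Nr j y ν y')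
    (hNt : ∀ j y ν y', trK (Nr j y ν y') = -sgnK (Nr j y ν y'))
    -- hR side: the reflection letters of the undressed comb-chart jets, diagonal contacts, tadpole-null remainder
    (c : ℕ → Fin 4 → Fin 4 → (Fin 4 → ℤ) → (Fin 4 → ℤ) → Fib 3 → ℝ) (Cc δc : ℕ → ℝ)
    (hC : ∀ j α, LocStencil (fun κ u => diagK (c j α κ u)) (Cc j) (δc j)) (hδc : ∀ j, 0 < δc j)
    (x₂ : ℕ → Fin 4 → Fin 4 → (Fin 4 → ℤ) → Fin 4 → (Fin 4 → ℤ) → (Fin 4 → ℤ) → Fib 3 → ℝ)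
    (hX₂ : ∀ j α μ y ν y', Loc (diagK (x₂ j α μ y ν y')))
    (Rm : ℕ → Fin 4 → Fin 4 → (Fin 4 → ℤ) → Fin 4 → (Fin 4 → ℤ) → MKer 4 (Fib 3))
    (hRmL : ∀ j α μ y ν y', Loc (Rm j α μ y ν y'))
    (hRm0 : ∀ j α μ y ν y', tadpole (GcombSh Lc j) (Rm j α μ y ν y') = 0)
    (hSrC : ∀ (j : ℕ) (α κ' : Fin 4) (u : Fin 4 → ℤ),
      (JsB12CombSh0 hLc N tabs cΛ cB j).S κ' (bref α κ' u) =
        reflSign α κ' • refK (Φ Lc α) ((JsB12CombSh0 hLc N tabs cΛ cB j).S κ' u + conjV (bhKStepSh 3 Lc (Dsh Lc) j) (diagK (c j α κ' u))))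
    (hWrC : ∀ (j : ℕ) (α μ : Fin 4) (y : Fin 4 → ℤ) (ν : Fin 4) (y' : Fin 4 → ℤ),
      (JsB12CombSh0 hLc N tabs cΛ cB j).W μ (bref α μ y) ν (bref α ν y') = (reflSign α μ * reflSign α ν) • refK (Φ Lc α)
        ((JsB12CombSh0 hLc N tabs cΛ cB j).W μ y ν y' +
          conjW (bhKStepSh 3 Lc (Dsh Lc) j) (vertexOfK (GcombSh Lc j) Lc (JsB12CombSh0 hLc N tabs cΛ cB j).S μ y)
            (vertexOfK (GcombSh Lc j) Lc (JsB12CombSh0 hLc N tabs cΛ cB j).S ν y')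
            (vertexOfK (GcombSh Lc j) Lc (fun κ u => diagK (c j α κ u)) μ y) (vertexOfK (GcombSh Lc j) Lc (fun κ u => diagK (c j α κ u)) ν y')
            (diagK (x₂ j α μ y ν y')) + Rm j α μ y ν y'))
    -- the route theorem's own binders, verbatim
    (a : ℝ) (ha : 0 < a)
    (h12 : B5.Prop12Printed (fam (fun i : ℕ+ × ℕ => ((i.1 : ℕ+) : ℕ)) (fun i => i.1.pos) MvE a ha))
    (h126 : B5.Kernel126_127Printed (kfam (fun i : ℕ+ × ℕ => ((i.1 : ℕ+) : ℕ)) MvE))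
    {L : Type*} {SL : Finset L} (hSL : SL.Nonempty) (k : L → Fin 4) {μ ν : Fin 4} (hμν : μ ≠ ν) {Nc : ℝ} (hNc : Nc ≠ 0)
    (Jc : ∀ m : ℕ, JetData 3 (Lc ^ m)) (htel : D1Tel Lc (JsB12CombShSym hLc N tabs cΛ cB) Jc)
    {cc : ℝ} {Mw : ℕ → ℕ} (hc : 1 ≤ cc) (hMw : ∀ L : ℕ, 2 ≤ L → 1 ≤ Mw L ∧ (L : ℝ) ≤ cc * Mw L) (hML : ∀ L : ℕ, 2 ≤ L → Mw L ≤ L)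
    (hrep : D1Rep Lc Jc Nc μ ν a SL k) :
    D1Drift Lc (JsB12CombShSym hLc N tabs cΛ cB) Nc μ ν :=
  d1Drift_JsB12CombShSym_of_hW_reflLettersRem_D1Tel_D1Rep hLc hL2 N tabs cΛ cB
    (wardTransversal_flipK_TbalOf_JsB12CombShSym_rel_parity hLc N tabs cΛ cB x hX X₂w hX₂w hEX₂w Nr hNr hSd hWd hNt)
    c Cc δc hC hδc x₂ hX₂ Rm hRmL hRm0 hSrC hWrC a ha h12 h126 hSL k hμν hNc Jc htel hc hMw hML hrep

end Summit.QuantumFields.BalabanUV.Beta.CombChartWardEnd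

end
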